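import Literature.MathematicalPhysics.QuantumFieldTheory.Balaban1983to89.B6Prop26Census2137KLevelV1
import Literature.MathematicalPhysics.QuantumFieldTheory.Balaban1983to89.B6Prop26Census2140KLevelV1
import Literature.MathematicalPhysics.QuantumFieldTheory.Balaban1983to89.B6Ineq2140GradKLevelCensusV1
import HarnessLib

/-!
# `Balaban1983to89.B6Prop26PrintedKLevelV1` — T. Bałaban, *Propagators and renormalization transformations for lattice gauge theories. II*,
Comm. Math. Phys. **96** (1984) 223–250 [Balaban1984PropagatorsII], p. 247 **PROPOSITION 2.6: THE VERBATIM CENSUS TYPING `…B6.Prop26Printed` ON THE GENUINE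
k-LEVEL V1 FAMILY — THE ASSEMBLY OF ITS FIVE CONJUNCTS (2.136)–(2.140)** (B6-CLOSURE §5 item 21, assembly file; fold owner r03).

HONEST FRAMING (programme rule): statement-level skeleton of published theorems with citation tags; proofs where landed; nothing here
is a claim about the Yang–Mills mass gap.

PRINT (verbatim, p. 247 [PDF 25]): «Proposition 2.6. There exists a positive constant δ₃ depending on d and L only, such that [(2.136)–(2.140)] … with
the constant O(1) depending on d and L only [resp. on d, L, α, ε].»  Census typing (`B6.Prop26Printed geo G`): `∃ M₁ δ₃ C Cα Cε Cαε, 0 < M₁ ∧ 0 < δ₃ ∧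
0 < C ∧ ∀ i, Hyp21_22 → M₁ ≤ M → Ineq2136_2140 (G i) C Cα Cε Cαε δ₃` — ONE threshold, ONE rate and ONE family of constants for all five displays.

## WHAT THIS FILE CERTIFIES (kernel-checked, sorry-free, standard axioms; THEOREMS ONLY)

* §1 nonnegativity of the census quantities of `kGeoG i` (`cutH`, `holder`, `cutSup`, `l2Norm`, `pref4`, `pref6`);
* §2 **`prop26Printed_kLevel_of_conjuncts`** — THE ASSEMBLY: the five conjuncts of `B6.Ineq2136_2140`, each known UNIFORMLY ON THE FAMILY with its own
  threshold, rate and constant(s) (the conclusion shapes of `B6Prop26Census2136KLevelV1.prop26_census2136_kLevel_of_div` (2.136),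
  `B6Prop26Census2137KLevelV1.prop26_census2137_kLevel_of_pairs` (2.137), `B6Prop26Census2140KLevelV1.prop26_census2140_kLevel_of_l2` (2.140), and the same
  shapes for (2.138) `e4` / (2.139) `h2`), give `B6.Prop26Printed (fun i : KIdx … => kGeoG i) (fun i => kG i)`: threshold = the largest, rate `δ₃` = the least
  (monotonicity of `e^{−δ d}` in `δ` for `d ≥ 0`, all other factors nonnegative), `C` = the larger of the (2.136)/(2.140) constants, `Cα, Cε, Cαε` = the given
  functions cut below at `0` (so that the rate may be lowered whatever their sign);
* §3 **`prop26Printed_kLevel_of_slots`** — THE VERBATIM CENSUS TYPING ON THE GENUINE k-LEVEL FAMILY MODULO THE DISPLAYED SLOT INPUTS: (2.136)₁,₂,₄, (2.140)₁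
  and the (2.137) assembly are fed BY NAME through the three conjunct files, and (2.140)₂,₃ BY NAME through p22's `B6Ineq2140GradKLevelCensusV1`
  (`ineq2140_grad(T)_kLevel_census_of_h3`, from `h3`); displayed remain `h3` ((2.136)₃), `hm1`/`hm2` ((2.137) pair majorants), `hl3 … hl5` ((2.140)₄₋₆),
  and the WHOLE conjuncts `c3` ((2.138)) and `c4` ((2.139)); non-vacuity is `B6Prop26Census2136KLevelV1.kLevelG_meets_hypotheses` (landed).

## HONEST SCOPE

An assembly of displayed inputs: this file proves no inequality of print; it fixes, once, the bookkeeping by which the verbatim `B6.Prop26Printed` follows from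
the five per-display census statements, so that the typing closes mechanically as the slot files land (each displayed binder is the literal conclusion
shape of the corresponding k-level programme).  Constants depend on `d, L` and the band (print: `d, L`).  NOT summit progress.  Unit `lit-balaban-r03`
(gen 26), 2026-08-24.
-/

noncomputable section

namespace Literature.MathematicalPhysics.QuantumFieldTheory.Balaban1983to89.B6Prop26PrintedKLevelV1

open LatticeFieldCalculus
open B6SectAOperatorsV1 (BondIdx)
open B6SectAVectorModelV1 (GE)
open B6Ineq2133TwoScaleV1 (onFun)
open B6RandomWalk (HasMajorant)
open B6MultiLevelBoxOperator (N0)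
open B6MultiLevelTorusOperator (TDomains)
open B6GlobalChartV1 (PV domT blkV1)
open B6Geom246MultiLevelTorus (geomT)
open B6Prop26KLevelAssemblyV1 (distT_nonneg)
open B6CubeWindowV1 (Placed GlobalBand)
open B6Cover236MultiLevelBlocks (cubes)
open B6GradLegKLevelV1 (DV)
open B6LapLegKLevelV1 (DVa)
open B6HolderPairMemberV1 (pairOp)
open B6KLevelCensusIndexV1 (KIdx Adm tpar kGeoG lenG_pos supNormG_nonneg tpar_nonneg)
open B6Prop26Census2136KLevelV1 (kG prop26_census2136_kLevel_of_div)
open B6Prop26Census2137KLevelV1 (prop26_census2137_kLevel_of_pairs)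
open B6Prop26Census2140KLevelV1 (prop26_census2140_kLevel_of_l2)
open B6Ineq2140GradKLevelCensusV1 (ineq2140_grad_kLevel_census_of_h3 ineq2140_gradT_kLevel_census_of_h3)

variable {d ℓ : ℕ} {hd : 1 ≤ d + 1} {hL : Odd (ℓ + 1) ∧ 1 < ℓ + 1} {b₀ b₁ : ℝ}

/-! ## §1  Nonnegativity of the census quantities -/

open Classical in
/-- `‖ζ‖^ξ_α + |ζ| ≥ 0`. [cite: Balaban1984PropagatorsII, (2.137) p.247, bookkeeping] -/
theorem cutH_nonneg (i : KIdx d ℓ hd hL b₀ b₁) (α : ℝ) (ζ : PBond (PV d ℓ i.m i.K hd hL) 0 → ℝ) : 0 ≤ (kGeoG i).cutH α ζ := by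
  refine add_nonneg (Real.iSup_nonneg fun _ => abs_nonneg _) (Real.iSup_nonneg fun q => ?_)
  split_ifs
  · exact mul_nonneg (Real.rpow_nonneg (tpar_nonneg i q.1 q.2) _) (abs_nonneg _)
  · exact le_rfl

open Classical in
/-- `‖J‖^{ξ′}_ε ≥ 0`. [cite: Balaban1984PropagatorsII, (2.138) p.247, bookkeeping] -/
theorem holder_nonneg (i : KIdx d ℓ hd hL b₀ b₁) (ε : ℝ) (J : PBond (PV d ℓ i.m i.K hd hL) 0 → ℝ) : 0 ≤ (kGeoG i).holder ε J := by
  refine Real.iSup_nonneg fun q => ?_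
  split_ifs
  · exact mul_nonneg (Real.rpow_nonneg (tpar_nonneg i q.1 q.2) _) (abs_nonneg _)
  · exact le_rfl

/-- `|h| ≥ 0` (the cut-off sup). [cite: Balaban1984PropagatorsII, (2.140) p.247, bookkeeping] -/
theorem cutSup_nonneg (i : KIdx d ℓ hd hL b₀ b₁) (h : PBond (PV d ℓ i.m i.K hd hL) 0 → ℝ) : 0 ≤ (kGeoG i).cutSup h :=
  supNormG_nonneg i h

/-- `‖J‖ ≥ 0`. [cite: Balaban1984PropagatorsII, (2.140) p.247, bookkeeping] -/
theorem l2Norm_nonneg (i : KIdx d ℓ hd hL b₀ b₁) (J : PBond (PV d ℓ i.m i.K hd hL) 0 → ℝ) : 0 ≤ (kGeoG i).l2Norm J :=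
  Real.sqrt_nonneg _

/-- `[(Lʲη)², Lʲη, Lʲη, 1]_n ≥ 0` for `Lʲη ≥ 0`. [cite: Balaban1984PropagatorsII, (2.136) p.247, bookkeeping] -/
theorem pref4_nonneg {t : ℝ} (ht : 0 ≤ t) (n : Fin 4) : 0 ≤ B6.pref4 t n := by
  fin_cases n
  · exact sq_nonneg t
  · exact ht
  · exact ht
  · exact zero_le_one

/-- `[(Lʲη)², Lʲη, Lʲη, 1, 1, 1]_n ≥ 0` for `Lʲη ≥ 0`. [cite: Balaban1984PropagatorsII, (2.140) p.247, bookkeeping] -/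
theorem pref6_nonneg {t : ℝ} (ht : 0 ≤ t) (n : Fin 6) : 0 ≤ B6.pref6 t n := by
  fin_cases n
  · exact sq_nonneg t
  · exact ht
  · exact ht
  · exact zero_le_one
  · exact zero_le_one
  · exact zero_le_one

/-! ## §2  The assembly of the five conjuncts -/

/-- **[B6] PROPOSITION 2.6 — THE VERBATIM CENSUS TYPING FROM ITS FIVE CONJUNCTS KNOWN UNIFORMLY ON THE GENUINE k-LEVEL FAMILY** (each with its own
threshold, rate, constants): one threshold (the largest), one rate (the least: `e^{−δₙd} ≤ e^{−δ₃d}` for `d ≥ 0`, the other factors being nonnegative), `C` =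
the larger of the (2.136)/(2.140) constants, `Cα, Cε, Cαε` cut below at `0`. [cite: Balaban1984PropagatorsII, Prop. 2.6 (2.136)–(2.141) p.247] -/
theorem prop26Printed_kLevel_of_conjuncts
    (c1 : ∃ M₁ δ₃ C : ℝ, 0 < M₁ ∧ 0 < δ₃ ∧ 0 < C ∧ ∀ i : KIdx d ℓ hd hL b₀ b₁, M₁ ≤ (kGeoG i).M →
      ∀ (n : Fin 4) (J : (kGeoG i).Loc) (y y' : (kGeoG i).Site), (kGeoG i).suppIn J y' →
        (kG i).e n J y ≤ C * B6.pref4 ((kGeoG i).len y) n * Real.exp (-(δ₃ * (kGeoG i).dist y y')) * (kGeoG i).supNorm J)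
    (c2 : ∃ M₁ δ₃ : ℝ, ∃ Cα : ℝ → ℝ, 0 < M₁ ∧ 0 < δ₃ ∧ ∀ i : KIdx d ℓ hd hL b₀ b₁, M₁ ≤ (kGeoG i).M →
      ∀ (α : ℝ) (J : (kGeoG i).Loc) (ζ : (kGeoG i).Cut) (y y' : (kGeoG i).Site), 0 ≤ α → α < 1 →
        (kGeoG i).cutIn ζ y → (kGeoG i).suppIn J y' →
        (kG i).h1 J α ζ ≤ Cα α * ((kGeoG i).len y) ^ (1 - α) * (kGeoG i).cutH α ζ *
          Real.exp (-(δ₃ * (kGeoG i).dist y y')) * (kGeoG i).supNorm J)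
    (c3 : ∃ M₁ δ₃ : ℝ, ∃ Cε : ℝ → ℝ, 0 < M₁ ∧ 0 < δ₃ ∧ ∀ i : KIdx d ℓ hd hL b₀ b₁, M₁ ≤ (kGeoG i).M →
      ∀ (ε : ℝ) (J : (kGeoG i).Loc) (y y' : (kGeoG i).Site), 0 < ε → ε < 1 → (kGeoG i).suppIn J y' →
        (kG i).e4 J y ≤ Cε ε * Real.exp (-(δ₃ * (kGeoG i).dist y y')) * ((kGeoG i).holder ε J + (kGeoG i).supNorm J))
    (c4 : ∃ M₁ δ₃ : ℝ, ∃ Cαε : ℝ → ℝ → ℝ, 0 < M₁ ∧ 0 < δ₃ ∧ ∀ i : KIdx d ℓ hd hL b₀ b₁, M₁ ≤ (kGeoG i).M →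
      ∀ (α ε : ℝ) (J : (kGeoG i).Loc) (ζ : (kGeoG i).Cut) (y y' : (kGeoG i).Site), 0 ≤ α → 0 < ε → α + ε < 1 →
        (kGeoG i).cutIn ζ y → (kGeoG i).suppIn J y' →
        (kG i).h2 J α ζ ≤ Cαε α ε * ((kGeoG i).len y) ^ (-α) * (kGeoG i).cutH α ζ * Real.exp (-(δ₃ * (kGeoG i).dist y y')) *
          ((kGeoG i).holder (α + ε) J + (kGeoG i).supNorm J))
    (c5 : ∃ M₁ δ₃ C : ℝ, 0 < M₁ ∧ 0 < δ₃ ∧ 0 < C ∧ ∀ i : KIdx d ℓ hd hL b₀ b₁, M₁ ≤ (kGeoG i).M →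
      ∀ (n : Fin 6) (J : (kGeoG i).Loc) (h : (kGeoG i).Cut) (y y' : (kGeoG i).Site), (kGeoG i).cutIn h y → (kGeoG i).suppIn J y' →
        (kG i).l2 n J h ≤ C * B6.pref6 ((kGeoG i).len y) n * (kGeoG i).cutSup h * Real.exp (-(δ₃ * (kGeoG i).dist y y')) *
          (kGeoG i).l2Norm J) :
    B6.Prop26Printed (fun i : KIdx d ℓ hd hL b₀ b₁ => kGeoG i) (fun i => kG i) := by
  obtain ⟨M1, δ1, C1, hM1, hδ1, hC1, H1⟩ := c1
  obtain ⟨M2, δ2, Cα, hM2, hδ2, H2⟩ := c2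
  obtain ⟨M3, δ3, Cε, hM3, hδ3, H3⟩ := c3
  obtain ⟨M4, δ4, Cαε, hM4, hδ4, H4⟩ := c4
  obtain ⟨M5, δ5, C5, hM5, hδ5, hC5, H5⟩ := c5
  -- the witnesses
  set Mx : ℝ := max (max (max M1 M2) (max M3 M4)) M5 with hMx_def
  set δm : ℝ := min (min (min δ1 δ2) (min δ3 δ4)) δ5 with hδm_def
  have hδm : 0 < δm := lt_min (lt_min (lt_min hδ1 hδ2) (lt_min hδ3 hδ4)) hδ5
  have hm1 : δm ≤ δ1 := ((min_le_left _ _).trans (min_le_left _ _)).trans (min_le_left _ _)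
  have hm2 : δm ≤ δ2 := ((min_le_left _ _).trans (min_le_left _ _)).trans (min_le_right _ _)
  have hm3 : δm ≤ δ3 := ((min_le_left _ _).trans (min_le_right _ _)).trans (min_le_left _ _)
  have hm4 : δm ≤ δ4 := ((min_le_left _ _).trans (min_le_right _ _)).trans (min_le_right _ _)
  have hm5 : δm ≤ δ5 := min_le_right _ _
  have hx1 : M1 ≤ Mx := ((le_max_left _ _).trans (le_max_left _ _)).trans (le_max_left _ _)
  have hx2 : M2 ≤ Mx := ((le_max_right _ _).trans (le_max_left _ _)).trans (le_max_left _ _)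
  have hx3 : M3 ≤ Mx := ((le_max_left _ _).trans (le_max_right _ _)).trans (le_max_left _ _)
  have hx4 : M4 ≤ Mx := ((le_max_right _ _).trans (le_max_right _ _)).trans (le_max_left _ _)
  have hx5 : M5 ≤ Mx := le_max_right _ _
  set C : ℝ := max C1 C5 with hC_def
  have hC : 0 < C := lt_max_of_lt_left hC1
  refine ⟨Mx, δm, C, fun α => max (Cα α) 0, fun ε => max (Cε ε) 0, fun α ε => max (Cαε α ε) 0, lt_of_lt_of_le hM1 hx1, hδm, hC,
    fun i _ hM => ?_⟩
  -- common comparisons at the index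
  have hrate : ∀ {δ : ℝ} (y y' : (kGeoG i).Site), δm ≤ δ →
      Real.exp (-(δ * (kGeoG i).dist y y')) ≤ Real.exp (-(δm * (kGeoG i).dist y y')) :=
    fun y y' h => Real.exp_le_exp.2 (neg_le_neg (mul_le_mul_of_nonneg_right h (distT_nonneg y y')))
  refine ⟨fun n J y y' hJ => ?_, fun α J ζ y y' hα0 hα1 hζ hJ => ?_, fun ε J y y' hε0 hε1 hJ => ?_,
    fun α ε J ζ y y' hα0 hε0 hαε hζ hJ => ?_, fun n J h y y' hh hJ => ?_⟩
  · -- (2.136)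
    have h := H1 i (hx1.trans hM) n J y y' hJ
    have hX : 0 ≤ B6.pref4 ((kGeoG i).len y) n := pref4_nonneg (lenG_pos i y).le n
    have hB : 0 ≤ (kGeoG i).supNorm J := supNormG_nonneg i J
    have hE := hrate y y' hm1
    have hC1C : C1 ≤ C := le_max_left _ _
    calc (kG i).e n J y ≤ C1 * B6.pref4 ((kGeoG i).len y) n * Real.exp (-(δ1 * (kGeoG i).dist y y')) * (kGeoG i).supNorm J := h
      _ ≤ C * B6.pref4 ((kGeoG i).len y) n * Real.exp (-(δm * (kGeoG i).dist y y')) * (kGeoG i).supNorm J := by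
        gcongr
  · -- (2.137)
    have h := H2 i (hx2.trans hM) α J ζ y y' hα0 hα1 hζ hJ
    have hX : 0 ≤ ((kGeoG i).len y) ^ (1 - α) * (kGeoG i).cutH α ζ :=
      mul_nonneg (Real.rpow_nonneg (lenG_pos i y).le _) (cutH_nonneg i α ζ)
    have hB : 0 ≤ (kGeoG i).supNorm J := supNormG_nonneg i J
    have hE := hrate y y' hm2
    have hE0 : 0 ≤ Real.exp (-(δ2 * (kGeoG i).dist y y')) := (Real.exp_pos _).le
    have hCC : Cα α ≤ max (Cα α) 0 := le_max_left _ _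
    have hC0 : 0 ≤ max (Cα α) 0 := le_max_right _ _
    calc (kG i).h1 J α ζ ≤ Cα α * ((kGeoG i).len y) ^ (1 - α) * (kGeoG i).cutH α ζ * Real.exp (-(δ2 * (kGeoG i).dist y y')) *
          (kGeoG i).supNorm J := h
      _ = Cα α * ((((kGeoG i).len y) ^ (1 - α) * (kGeoG i).cutH α ζ) * Real.exp (-(δ2 * (kGeoG i).dist y y')) *
          (kGeoG i).supNorm J) := by ring
      _ ≤ max (Cα α) 0 * ((((kGeoG i).len y) ^ (1 - α) * (kGeoG i).cutH α ζ) * Real.exp (-(δm * (kGeoG i).dist y y')) *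
          (kGeoG i).supNorm J) := by
        refine mul_le_mul hCC (mul_le_mul_of_nonneg_right (mul_le_mul_of_nonneg_left hE hX) hB) ?_ hC0
        exact mul_nonneg (mul_nonneg hX hE0) hB
      _ = max (Cα α) 0 * ((kGeoG i).len y) ^ (1 - α) * (kGeoG i).cutH α ζ * Real.exp (-(δm * (kGeoG i).dist y y')) *
          (kGeoG i).supNorm J := by ring
  · -- (2.138)
    have h := H3 i (hx3.trans hM) ε J y y' hε0 hε1 hJ
    have hB : 0 ≤ (kGeoG i).holder ε J + (kGeoG i).supNorm J := add_nonneg (holder_nonneg i ε J) (supNormG_nonneg i J)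
    have hE := hrate y y' hm3
    have hE0 : 0 ≤ Real.exp (-(δ3 * (kGeoG i).dist y y')) := (Real.exp_pos _).le
    have hCC : Cε ε ≤ max (Cε ε) 0 := le_max_left _ _
    have hC0 : 0 ≤ max (Cε ε) 0 := le_max_right _ _
    calc (kG i).e4 J y ≤ Cε ε * Real.exp (-(δ3 * (kGeoG i).dist y y')) * ((kGeoG i).holder ε J + (kGeoG i).supNorm J) := h
      _ = Cε ε * (Real.exp (-(δ3 * (kGeoG i).dist y y')) * ((kGeoG i).holder ε J + (kGeoG i).supNorm J)) := by ring
      _ ≤ max (Cε ε) 0 * (Real.exp (-(δm * (kGeoG i).dist y y')) * ((kGeoG i).holder ε J + (kGeoG i).supNorm J)) :=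
        mul_le_mul hCC (mul_le_mul_of_nonneg_right hE hB) (mul_nonneg hE0 hB) hC0
      _ = max (Cε ε) 0 * Real.exp (-(δm * (kGeoG i).dist y y')) * ((kGeoG i).holder ε J + (kGeoG i).supNorm J) := by ring
  · -- (2.139)
    have h := H4 i (hx4.trans hM) α ε J ζ y y' hα0 hε0 hαε hζ hJ
    have hX : 0 ≤ ((kGeoG i).len y) ^ (-α) * (kGeoG i).cutH α ζ :=
      mul_nonneg (Real.rpow_nonneg (lenG_pos i y).le _) (cutH_nonneg i α ζ)
    have hB : 0 ≤ (kGeoG i).holder (α + ε) J + (kGeoG i).supNorm J := add_nonneg (holder_nonneg i _ J) (supNormG_nonneg i J)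
    have hE := hrate y y' hm4
    have hE0 : 0 ≤ Real.exp (-(δ4 * (kGeoG i).dist y y')) := (Real.exp_pos _).le
    have hCC : Cαε α ε ≤ max (Cαε α ε) 0 := le_max_left _ _
    have hC0 : 0 ≤ max (Cαε α ε) 0 := le_max_right _ _
    calc (kG i).h2 J α ζ ≤ Cαε α ε * ((kGeoG i).len y) ^ (-α) * (kGeoG i).cutH α ζ * Real.exp (-(δ4 * (kGeoG i).dist y y')) *
          ((kGeoG i).holder (α + ε) J + (kGeoG i).supNorm J) := h
      _ = Cαε α ε * ((((kGeoG i).len y) ^ (-α) * (kGeoG i).cutH α ζ) * Real.exp (-(δ4 * (kGeoG i).dist y y')) *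
          ((kGeoG i).holder (α + ε) J + (kGeoG i).supNorm J)) := by ring
      _ ≤ max (Cαε α ε) 0 * ((((kGeoG i).len y) ^ (-α) * (kGeoG i).cutH α ζ) * Real.exp (-(δm * (kGeoG i).dist y y')) *
          ((kGeoG i).holder (α + ε) J + (kGeoG i).supNorm J)) := by
        refine mul_le_mul hCC (mul_le_mul_of_nonneg_right (mul_le_mul_of_nonneg_left hE hX) hB) ?_ hC0
        exact mul_nonneg (mul_nonneg hX hE0) hB
      _ = max (Cαε α ε) 0 * ((kGeoG i).len y) ^ (-α) * (kGeoG i).cutH α ζ * Real.exp (-(δm * (kGeoG i).dist y y')) *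
          ((kGeoG i).holder (α + ε) J + (kGeoG i).supNorm J) := by ring
  · -- (2.140)
    have h' := H5 i (hx5.trans hM) n J h y y' hh hJ
    have hX : 0 ≤ B6.pref6 ((kGeoG i).len y) n * (kGeoG i).cutSup h := mul_nonneg (pref6_nonneg (lenG_pos i y).le n) (cutSup_nonneg i h)
    have hB : 0 ≤ (kGeoG i).l2Norm J := l2Norm_nonneg i J
    have hE := hrate y y' hm5
    have hE0 : 0 ≤ Real.exp (-(δ5 * (kGeoG i).dist y y')) := (Real.exp_pos _).le
    have hC5C : C5 ≤ C := le_max_right _ _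
    calc (kG i).l2 n J h ≤ C5 * B6.pref6 ((kGeoG i).len y) n * (kGeoG i).cutSup h * Real.exp (-(δ5 * (kGeoG i).dist y y')) *
          (kGeoG i).l2Norm J := h'
      _ = C5 * ((B6.pref6 ((kGeoG i).len y) n * (kGeoG i).cutSup h) * Real.exp (-(δ5 * (kGeoG i).dist y y')) * (kGeoG i).l2Norm J) := by
          ring
      _ ≤ C * ((B6.pref6 ((kGeoG i).len y) n * (kGeoG i).cutSup h) * Real.exp (-(δm * (kGeoG i).dist y y')) * (kGeoG i).l2Norm J) := by
        refine mul_le_mul hC5C (mul_le_mul_of_nonneg_right (mul_le_mul_of_nonneg_left hE hX) hB) ?_ hC.le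
        exact mul_nonneg (mul_nonneg hX hE0) hB
      _ = C * B6.pref6 ((kGeoG i).len y) n * (kGeoG i).cutSup h * Real.exp (-(δm * (kGeoG i).dist y y')) * (kGeoG i).l2Norm J := by ring

/-! ## §3  The verbatim census typing on the genuine k-level family, modulo the displayed slot inputs -/

/-- **[B6] PROPOSITION 2.6, THE VERBATIM CENSUS TYPING `B6.Prop26Printed` ON THE GENUINE k-LEVEL V1 FAMILY MODULO THE DISPLAYED SLOT INPUTS**:
(2.136)₁,₂,₄ (p38 F6), (2.140)₁ (p22) and the assemblies of the three conjunct files are fed BY NAME; displayed remain `h3` ((2.136)₃: the k-level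
majorant of `G∇*_ν`), `hm1`/`hm2` (the (2.137) pair majorants of `∇_νG`/`G∇*_ν`), `hl3 … hl5` (the exact-block `L²` bounds (2.140)₄₋₆; (2.140)₂,₃ come from `h3`
through p22's `ineq2140_grad(T)_kLevel_census_of_h3`), and the whole conjuncts `c3` ((2.138)) / `c4` ((2.139)) in census form. [cite: Balaban1984PropagatorsII, Prop. 2.6 (2.136)–(2.141) p.247] -/
theorem prop26Printed_kLevel_of_slots (hb₀ : 0 < b₀) (hb₁ : b₀ ≤ b₁)
    (h3 : ∃ (δ A M₂ : ℝ) (N₁ : ℕ), 0 < δ ∧ 0 ≤ A ∧ 0 < M₂ ∧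
      ∀ (m K : ℕ) {Mh k R : ℕ} {P' : Fin (d + 1) → ℕ}
        (hN : ∀ μ, N0 ℓ Mh k P' μ = (PV d ℓ m K hd hL).sitesPerDir 0) (D : TDomains d ℓ Mh k P' R) (hk : k ≤ m + K) (_ : 2 ≤ k)
        {a : ℕ} (_ : Mh = (ℓ + 1) ^ a) (_ : 8 ≤ Mh) (_ : 2 * (ℓ + 1) ^ 2 ≤ R) (_ : ∀ μ, 5 ≤ P' μ) (_ : 4 ≤ ℓ)
        (_ : ∀ c : ↥(cubes D.toDomains), Placed ℓ k P' c.1) (_ : M₂ ≤ ((ℓ : ℝ) + 1) * Mh) (_ : N₁ + 1 ≤ R * ((ℓ + 1) * Mh))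
        {cf : ℝ} (hcf : cf ≠ 0) {w : BondIdx (domT hN D hk) → ℝ} (hw : ∀ i, 0 < w i) (_ : GlobalBand b₀ b₁ cf w) (ν : Fin (d + 1)),
        HasMajorant (g := geomT D) (blkV1 hN D) (onFun (GE (domT hN D hk) hcf hw) ∘ₗ DVa ν cf)
          (fun y y' => A * ((geomT D).len y * |cf|⁻¹) * Real.exp (-(δ * (geomT D).dist y y'))))
    (hm1 : ∃ (δ M₂ : ℝ) (N₁ : ℕ), 0 < δ ∧ 0 < M₂ ∧ ∀ (α : ℝ), 0 ≤ α → α < 1 → ∃ A : ℝ, 0 ≤ A ∧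
      ∀ (m K : ℕ) {Mh k R : ℕ} {P' : Fin (d + 1) → ℕ}
        (hN : ∀ μ, N0 ℓ Mh k P' μ = (PV d ℓ m K hd hL).sitesPerDir 0) (D : TDomains d ℓ Mh k P' R) (hk : k ≤ m + K) (_ : 2 ≤ k)
        {a : ℕ} (_ : Mh = (ℓ + 1) ^ a) (_ : 8 ≤ Mh) (_ : 2 * (ℓ + 1) ^ 2 ≤ R) (_ : ∀ μ, 5 ≤ P' μ) (_ : 4 ≤ ℓ)
        (_ : ∀ c : ↥(cubes D.toDomains), Placed ℓ k P' c.1) (_ : M₂ ≤ ((ℓ : ℝ) + 1) * Mh) (_ : N₁ + 1 ≤ R * ((ℓ + 1) * Mh))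
        {cf : ℝ} (hcf : cf ≠ 0) {w : BondIdx (domT hN D hk) → ℝ} (hw : ∀ i, 0 < w i) (_ : GlobalBand b₀ b₁ cf w)
        (ν : Fin (d + 1)) (x x' : PBond (PV d ℓ m K hd hL) 0), x.dir = x'.dir →
        supDist x.src x'.src ≤ (ℓ + 1) ^ (blkV1 hN D x).1.1 → supDist x.src x'.src ≤ (ℓ + 1) ^ (blkV1 hN D x').1.1 →
        HasMajorant (g := geomT D) (blkV1 hN D) (pairOp x x' * DV (P := PV d ℓ m K hd hL) ν cf * onFun (GE (domT hN D hk) hcf hw))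
          (fun y y' => A * ((((supDist x.src x'.src : ℕ) : ℝ) / (((ℓ + 1 : ℕ) : ℝ)) ^ (blkV1 hN D x).1.1) ^ α *
            ((geomT D).len y * |cf|⁻¹)) * Real.exp (-(δ * (geomT D).dist y y'))))
    (hm2 : ∃ (δ M₂ : ℝ) (N₁ : ℕ), 0 < δ ∧ 0 < M₂ ∧ ∀ (α : ℝ), 0 ≤ α → α < 1 → ∃ A : ℝ, 0 ≤ A ∧
      ∀ (m K : ℕ) {Mh k R : ℕ} {P' : Fin (d + 1) → ℕ}
        (hN : ∀ μ, N0 ℓ Mh k P' μ = (PV d ℓ m K hd hL).sitesPerDir 0) (D : TDomains d ℓ Mh k P' R) (hk : k ≤ m + K) (_ : 2 ≤ k)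
        {a : ℕ} (_ : Mh = (ℓ + 1) ^ a) (_ : 8 ≤ Mh) (_ : 2 * (ℓ + 1) ^ 2 ≤ R) (_ : ∀ μ, 5 ≤ P' μ) (_ : 4 ≤ ℓ)
        (_ : ∀ c : ↥(cubes D.toDomains), Placed ℓ k P' c.1) (_ : M₂ ≤ ((ℓ : ℝ) + 1) * Mh) (_ : N₁ + 1 ≤ R * ((ℓ + 1) * Mh))
        {cf : ℝ} (hcf : cf ≠ 0) {w : BondIdx (domT hN D hk) → ℝ} (hw : ∀ i, 0 < w i) (_ : GlobalBand b₀ b₁ cf w)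
        (ν : Fin (d + 1)) (x x' : PBond (PV d ℓ m K hd hL) 0), x.dir = x'.dir →
        supDist x.src x'.src ≤ (ℓ + 1) ^ (blkV1 hN D x).1.1 → supDist x.src x'.src ≤ (ℓ + 1) ^ (blkV1 hN D x').1.1 →
        HasMajorant (g := geomT D) (blkV1 hN D) (pairOp x x' * onFun (GE (domT hN D hk) hcf hw) * DVa ν cf)
          (fun y y' => A * ((((supDist x.src x'.src : ℕ) : ℝ) / (((ℓ + 1 : ℕ) : ℝ)) ^ (blkV1 hN D x).1.1) ^ α *
            ((geomT D).len y * |cf|⁻¹)) * Real.exp (-(δ * (geomT D).dist y y'))))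
    (hl3 : ∃ (δ A M₂ : ℝ) (N₁ : ℕ), 0 < δ ∧ 0 ≤ A ∧ 0 < M₂ ∧
      ∀ (m K : ℕ) {Mh k R : ℕ} {P' : Fin (d + 1) → ℕ}
        (hN : ∀ μ, N0 ℓ Mh k P' μ = (PV d ℓ m K hd hL).sitesPerDir 0) (D : TDomains d ℓ Mh k P' R) (hk : k ≤ m + K) (_ : 2 ≤ k)
        {a : ℕ} (_ : Mh = (ℓ + 1) ^ a) (_ : 8 ≤ Mh) (_ : 2 * (ℓ + 1) ^ 2 ≤ R) (_ : ∀ μ, 5 ≤ P' μ) (_ : 4 ≤ ℓ)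
        (_ : ∀ c : ↥(cubes D.toDomains), Placed ℓ k P' c.1) (_ : M₂ ≤ ((ℓ : ℝ) + 1) * Mh) (_ : N₁ + 1 ≤ R * ((ℓ + 1) * Mh))
        {cf : ℝ} (hcf : cf ≠ 0) {w : BondIdx (domT hN D hk) → ℝ} (hw : ∀ i, 0 < w i) (_ : GlobalBand b₀ b₁ cf w)
        (ν μ : Fin (d + 1)) (y y' : (geomT D).Site) (ζ J : PBond (PV d ℓ m K hd hL) 0 → ℝ) {s : ℝ} (_ : 0 ≤ s)
        (_ : ∀ x, blkV1 hN D x ≠ y → ζ x = 0) (_ : ∀ x, |ζ x| ≤ s) (_ : ∀ x, blkV1 hN D x ≠ y' → J x = 0),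
        ∑ x, (ζ x * (DV ν cf ∘ₗ onFun (GE (domT hN D hk) hcf hw) ∘ₗ DVa μ cf) J x) ^ 2 ≤
          (A * Real.exp (-(δ * (geomT D).dist y y')) * s) ^ 2 * ∑ x, J x ^ 2)
    (hl4 : ∃ (δ A M₂ : ℝ) (N₁ : ℕ), 0 < δ ∧ 0 ≤ A ∧ 0 < M₂ ∧
      ∀ (m K : ℕ) {Mh k R : ℕ} {P' : Fin (d + 1) → ℕ}
        (hN : ∀ μ, N0 ℓ Mh k P' μ = (PV d ℓ m K hd hL).sitesPerDir 0) (D : TDomains d ℓ Mh k P' R) (hk : k ≤ m + K) (_ : 2 ≤ k)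
        {a : ℕ} (_ : Mh = (ℓ + 1) ^ a) (_ : 8 ≤ Mh) (_ : 2 * (ℓ + 1) ^ 2 ≤ R) (_ : ∀ μ, 5 ≤ P' μ) (_ : 4 ≤ ℓ)
        (_ : ∀ c : ↥(cubes D.toDomains), Placed ℓ k P' c.1) (_ : M₂ ≤ ((ℓ : ℝ) + 1) * Mh) (_ : N₁ + 1 ≤ R * ((ℓ + 1) * Mh))
        {cf : ℝ} (hcf : cf ≠ 0) {w : BondIdx (domT hN D hk) → ℝ} (hw : ∀ i, 0 < w i) (_ : GlobalBand b₀ b₁ cf w)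
        (ν μ : Fin (d + 1)) (y y' : (geomT D).Site) (ζ J : PBond (PV d ℓ m K hd hL) 0 → ℝ) {s : ℝ} (_ : 0 ≤ s)
        (_ : ∀ x, blkV1 hN D x ≠ y → ζ x = 0) (_ : ∀ x, |ζ x| ≤ s) (_ : ∀ x, blkV1 hN D x ≠ y' → J x = 0),
        ∑ x, (ζ x * (DV ν cf ∘ₗ DV μ cf ∘ₗ onFun (GE (domT hN D hk) hcf hw)) J x) ^ 2 ≤
          (A * Real.exp (-(δ * (geomT D).dist y y')) * s) ^ 2 * ∑ x, J x ^ 2)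
    (hl5 : ∃ (δ A M₂ : ℝ) (N₁ : ℕ), 0 < δ ∧ 0 ≤ A ∧ 0 < M₂ ∧
      ∀ (m K : ℕ) {Mh k R : ℕ} {P' : Fin (d + 1) → ℕ}
        (hN : ∀ μ, N0 ℓ Mh k P' μ = (PV d ℓ m K hd hL).sitesPerDir 0) (D : TDomains d ℓ Mh k P' R) (hk : k ≤ m + K) (_ : 2 ≤ k)
        {a : ℕ} (_ : Mh = (ℓ + 1) ^ a) (_ : 8 ≤ Mh) (_ : 2 * (ℓ + 1) ^ 2 ≤ R) (_ : ∀ μ, 5 ≤ P' μ) (_ : 4 ≤ ℓ)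
        (_ : ∀ c : ↥(cubes D.toDomains), Placed ℓ k P' c.1) (_ : M₂ ≤ ((ℓ : ℝ) + 1) * Mh) (_ : N₁ + 1 ≤ R * ((ℓ + 1) * Mh))
        {cf : ℝ} (hcf : cf ≠ 0) {w : BondIdx (domT hN D hk) → ℝ} (hw : ∀ i, 0 < w i) (_ : GlobalBand b₀ b₁ cf w)
        (ν μ : Fin (d + 1)) (y y' : (geomT D).Site) (ζ J : PBond (PV d ℓ m K hd hL) 0 → ℝ) {s : ℝ} (_ : 0 ≤ s)
        (_ : ∀ x, blkV1 hN D x ≠ y → ζ x = 0) (_ : ∀ x, |ζ x| ≤ s) (_ : ∀ x, blkV1 hN D x ≠ y' → J x = 0),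
        ∑ x, (ζ x * (onFun (GE (domT hN D hk) hcf hw) ∘ₗ DVa ν cf ∘ₗ DVa μ cf) J x) ^ 2 ≤
          (A * Real.exp (-(δ * (geomT D).dist y y')) * s) ^ 2 * ∑ x, J x ^ 2)
    (c3 : ∃ M₁ δ₃ : ℝ, ∃ Cε : ℝ → ℝ, 0 < M₁ ∧ 0 < δ₃ ∧ ∀ i : KIdx d ℓ hd hL b₀ b₁, M₁ ≤ (kGeoG i).M →
      ∀ (ε : ℝ) (J : (kGeoG i).Loc) (y y' : (kGeoG i).Site), 0 < ε → ε < 1 → (kGeoG i).suppIn J y' →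
        (kG i).e4 J y ≤ Cε ε * Real.exp (-(δ₃ * (kGeoG i).dist y y')) * ((kGeoG i).holder ε J + (kGeoG i).supNorm J))
    (c4 : ∃ M₁ δ₃ : ℝ, ∃ Cαε : ℝ → ℝ → ℝ, 0 < M₁ ∧ 0 < δ₃ ∧ ∀ i : KIdx d ℓ hd hL b₀ b₁, M₁ ≤ (kGeoG i).M →
      ∀ (α ε : ℝ) (J : (kGeoG i).Loc) (ζ : (kGeoG i).Cut) (y y' : (kGeoG i).Site), 0 ≤ α → 0 < ε → α + ε < 1 →
        (kGeoG i).cutIn ζ y → (kGeoG i).suppIn J y' →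
        (kG i).h2 J α ζ ≤ Cαε α ε * ((kGeoG i).len y) ^ (-α) * (kGeoG i).cutH α ζ * Real.exp (-(δ₃ * (kGeoG i).dist y y')) *
          ((kGeoG i).holder (α + ε) J + (kGeoG i).supNorm J)) :
    B6.Prop26Printed (fun i : KIdx d ℓ hd hL b₀ b₁ => kGeoG i) (fun i => kG i) :=
  prop26Printed_kLevel_of_conjuncts (prop26_census2136_kLevel_of_div hb₀ hb₁ h3) (prop26_census2137_kLevel_of_pairs hb₀ hb₁ hm1 hm2 h3) c3 c4
    (prop26_census2140_kLevel_of_l2 hb₀ hb₁ (ineq2140_grad_kLevel_census_of_h3 hb₀ hb₁ h3) (ineq2140_gradT_kLevel_census_of_h3 hb₀ hb₁ h3)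
      hl3 hl4 hl5)

-- Non-vacuity of the family at `L = 5` for every census threshold: `B6Prop26Census2136KLevelV1.kLevelG_meets_hypotheses` (landed; not re-exported —
-- the gate's dedup rule).

end Literature.MathematicalPhysics.QuantumFieldTheory.Balaban1983to89.B6Prop26PrintedKLevelV1

end
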